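import Literature.NumberTheory.Automorphic.AutomorphicRepCohomology
import Literature.NumberTheory.Automorphic.GKModuleTensor
import HarnessLib

/-!
# `H^q(𝔤, K_∞; π ⊗ E)`: automorphic cohomology with coefficients and its smooth `G(𝔸_f)`-action

Topic `NumberTheory/Automorphic`; companion of `AutomorphicRepCohomology` (`gkCohomologyRep`,
`AutomorphicRepData.gkCohomology`, `cohomologyRep`, `cohomologyRep_isSmooth`) with a coefficient
`(𝔤, K)`-module `E = (σK, σ𝔤)` tensored on (`GKModuleTensor`: `GKTensor.lie`, `GKTensor.ad_compat`,
`GKTensor.cohomology`).  Definitions with bodies and theorems; no named fact, no `sorry`.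

* `GKTensor.rTensor_comm_lie`, `GKTensor.rTensor_comm_tprod` — `T ⊗ 1` commutes with the Leibniz
  `𝔤`-action and the diagonal `K`-action on `V ⊗ E` when `T` commutes with `ρ𝔤`, `ρK`;
  `GKTensor.cohomologyRep … r … q : Representation ℂ Γ (H^q(𝔤, K; V ⊗ E))` — **a group acting
  on `V` by `(𝔤, K)`-maps acts on `H^q(𝔤, K; V ⊗ E)` through `r ⊗ 1`**
  [cite: BorelWallach2000, I §5.1];
* `Representation.IsSmooth.tprod_one` — smoothness (open stabilisers) passes from `r` to `r ⊗ 1`;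
* `AutomorphicRepData.gkCohomologyWith π σK σ𝔤 hE h𝒟 hρ q` — **`H^q(𝔤, K_∞; π ⊗ E)`**;
  `cohomologyRepWith` — **its `G(𝔸_f)`-action** `r(h) ⊗ 1`; `cohomologyRepWith_isSmooth` —
  **it is a smooth `G(𝔸_f)`-module** [cite: BorelJacquet1979, 4.6 with 4.2(a), 4.3]
  [cite: BorelWallach2000, I §5.1].

With `E` a finite-dimensional representation of `G_∞` (`GKModuleOfDifferentiableRep`,
`GKModuleStandardRep`, `GKModuleTensor`, `GKSubquotient`) these are the summands
`H^q(𝔤, K_∞; π ⊗ E) = H^q(𝔤, K_∞; π_∞ ⊗ E) ⊗ π_f` of the automorphic description of the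
cohomology of arithmetic groups with coefficients in `E`.

## Mathlib / Literature search

Tree only (`AutomorphicRepCohomology`, `GKModuleTensor`, `SmoothRepresentation`);
`lean search 'cohomologyRepWith|gkCohomologyWith|tprod_one'`: no hits.

## References

* A. Borel, H. Jacquet (1979), 4.2–4.6 [BorelJacquet1979].
* A. Borel, N. Wallach (2000), I §5.1 (held) [BorelWallach2000].
-/

noncomputable section

namespace Literature.NumberTheory.Automorphic

open Module Literature.Algebra.Lie

-- Mathlib idiom (as in `GKModules`): commutator bracket on `Module.End`
attribute [local instance 100] LieRing.ofAssociativeRing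

section TensorCoeff

open TensorProduct

variable {A : Type*} [NormedCommRing A] [NormedAlgebra ℝ A] [NormedAlgebra ℚ A] [CompleteSpace A]
  [StarRing A] {N : Type*} [Fintype N] [DecidableEq N] (G : RealMatrixGroup A N)
  {V : Type*} [AddCommGroup V] [Module ℂ V]
  (ρK : Representation ℂ G.maximalCompact V) (ρ𝔤 : G.lie →ₗ⁅ℝ⁆ Module.End ℂ V)
  {W : Type*} [AddCommGroup W] [Module ℂ W]
  (σK : Representation ℂ G.maximalCompact W) (σ𝔤 : G.lie →ₗ⁅ℝ⁆ Module.End ℂ W)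

namespace GKTensor

/-- `T ⊗ 1` commutes with the Leibniz `𝔤`-action on `V ⊗ W` when `T` commutes with `ρ𝔤`.
[folklore] -/
theorem rTensor_comm_lie (T : V →ₗ[ℂ] V) (hT𝔤 : ∀ X : G.lie, T ∘ₗ ρ𝔤 X = ρ𝔤 X ∘ₗ T)
    (X : G.lie) :
    T.rTensor W ∘ₗ GKTensor.lie G ρ𝔤 σ𝔤 X = GKTensor.lie G ρ𝔤 σ𝔤 X ∘ₗ T.rTensor W := by
  refine TensorProduct.ext' fun v w => ?_
  simp only [LinearMap.coe_comp, Function.comp_apply, LinearMap.rTensor_tmul,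
    GKTensor.lie_apply_tmul, map_add]
  rw [← LinearMap.comp_apply (f := T), hT𝔤 X, LinearMap.comp_apply]

/-- `T ⊗ 1` commutes with the diagonal `K`-action `ρK ⊗ σK` when `T` commutes with `ρK`.
[folklore] -/
theorem rTensor_comm_tprod (T : V →ₗ[ℂ] V)
    (hTK : ∀ k : G.maximalCompact, T ∘ₗ ρK k = ρK k ∘ₗ T) (k : G.maximalCompact) :
    T.rTensor W ∘ₗ ρK.tprod σK k = ρK.tprod σK k ∘ₗ T.rTensor W := by
  refine TensorProduct.ext' fun v w => ?_
  simp only [LinearMap.coe_comp, Function.comp_apply, LinearMap.rTensor_tmul,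
    Representation.tprod_apply, TensorProduct.map_tmul]
  rw [← LinearMap.comp_apply (f := T), hTK k, LinearMap.comp_apply]

variable [StarModule ℝ A]

/-- **A group acting on `V` by `(𝔤, K)`-maps acts on `H^q(𝔤, K; V ⊗ W)`** through `r ⊗ 1`.
[cite: BorelWallach2000, I §5.1] -/
def cohomologyRep {Γ : Type*} [Group Γ]
    (hV : ∀ (k : G.maximalCompact) (X : G.lie),
      ρK k ∘ₗ ρ𝔤 X ∘ₗ ρK k⁻¹ = ρ𝔤 (G.Ad (Subgroup.inclusion G.maximalCompact_le_carrier k) X))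
    (hW : ∀ (k : G.maximalCompact) (X : G.lie),
      σK k ∘ₗ σ𝔤 X ∘ₗ σK k⁻¹ = σ𝔤 (G.Ad (Subgroup.inclusion G.maximalCompact_le_carrier k) X))
    (r : Representation ℂ Γ V)
    (hr𝔤 : ∀ (γ : Γ) (X : G.lie), r γ ∘ₗ ρ𝔤 X = ρ𝔤 X ∘ₗ r γ)
    (hrK : ∀ (γ : Γ) (k : G.maximalCompact), r γ ∘ₗ ρK k = ρK k ∘ₗ r γ) (q : ℕ) :
    Representation ℂ Γ (GKTensor.cohomology G ρK ρ𝔤 σK σ𝔤 hV hW q) :=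
  gkCohomologyRep G (ρK.tprod σK) (GKTensor.lie G ρ𝔤 σ𝔤) (GKTensor.ad_compat G ρK ρ𝔤 σK σ𝔤 hV hW)
    (r.tprod (1 : Representation ℂ Γ W))
    (fun γ X => rTensor_comm_lie G ρ𝔤 σ𝔤 (r γ) (hr𝔤 γ) X)
    (fun γ k => rTensor_comm_tprod G ρK σK (r γ) (hrK γ) k) q

/-- Unfolding. [folklore] -/
theorem cohomologyRep_apply {Γ : Type*} [Group Γ]
    (hV : ∀ (k : G.maximalCompact) (X : G.lie),
      ρK k ∘ₗ ρ𝔤 X ∘ₗ ρK k⁻¹ = ρ𝔤 (G.Ad (Subgroup.inclusion G.maximalCompact_le_carrier k) X))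
    (hW : ∀ (k : G.maximalCompact) (X : G.lie),
      σK k ∘ₗ σ𝔤 X ∘ₗ σK k⁻¹ = σ𝔤 (G.Ad (Subgroup.inclusion G.maximalCompact_le_carrier k) X))
    (r : Representation ℂ Γ V)
    (hr𝔤 : ∀ (γ : Γ) (X : G.lie), r γ ∘ₗ ρ𝔤 X = ρ𝔤 X ∘ₗ r γ)
    (hrK : ∀ (γ : Γ) (k : G.maximalCompact), r γ ∘ₗ ρK k = ρK k ∘ₗ r γ) (q : ℕ) (γ : Γ) :
    cohomologyRep G ρK ρ𝔤 σK σ𝔤 hV hW r hr𝔤 hrK q γ =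
      gkCohomologyHom G (ρK.tprod σK) (GKTensor.lie G ρ𝔤 σ𝔤) (ρK.tprod σK) (GKTensor.lie G ρ𝔤 σ𝔤)
        (GKTensor.ad_compat G ρK ρ𝔤 σK σ𝔤 hV hW) (GKTensor.ad_compat G ρK ρ𝔤 σK σ𝔤 hV hW)
        ((r γ).rTensor W) (rTensor_comm_lie G ρ𝔤 σ𝔤 (r γ) (hr𝔤 γ))
        (rTensor_comm_tprod G ρK σK (r γ) (hrK γ)) q := rfl

end GKTensor

omit [NormedAlgebra ℚ A] [CompleteSpace A] [StarRing A] [Fintype N] [DecidableEq N] in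
/-- **Smoothness passes to `r ⊗ 1`**: if every vector of `V` has open stabiliser in the
topological group `Γ`, so does every vector of `V ⊗ W` for `r ⊗ 1` (pure tensors `v ⊗ w` are
fixed by the stabiliser of `v`; finite sums). [folklore] -/
theorem Representation.IsSmooth.tprod_one {Γ : Type*} [Group Γ] [TopologicalSpace Γ]
    [SeparatelyContinuousMul Γ] {r : Representation ℂ Γ V} (hr : r.IsSmooth) (W : Type*)
    [AddCommGroup W] [Module ℂ W] : (r.tprod (1 : Representation ℂ Γ W)).IsSmooth := by
  intro x
  induction x using TensorProduct.induction_on with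
  | zero => exact Representation.isSmoothVector_zero _
  | tmul v w =>
    refine (r.tprod (1 : Representation ℂ Γ W)).isSmoothVector_of_le (hr v) fun g hg => ?_
    simp only [Representation.mem_stabilizerSubgroup] at hg ⊢
    rw [Representation.tprod_apply, TensorProduct.map_tmul, hg]
    rfl
  | add x y hx hy =>
    refine (r.tprod (1 : Representation ℂ Γ W)).isSmoothVector_of_le
      (K := (r.tprod (1 : Representation ℂ Γ W)).stabilizerSubgroup x ⊓
        (r.tprod (1 : Representation ℂ Γ W)).stabilizerSubgroup y)
      (IsOpen.inter hx hy) fun g hg => ?_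
    simp only [Subgroup.mem_inf, Representation.mem_stabilizerSubgroup] at hg ⊢
    rw [map_add, hg.1, hg.2]

end TensorCoeff

namespace AutomorphicRepData

variable {K : Type} [Field K] [NumberField K]
  {A : Type*} [NormedCommRing A] [NormedAlgebra ℝ A] [NormedAlgebra ℚ A] [CompleteSpace A]
  [StarRing A] {N : Type*} [Fintype N] [DecidableEq N]
  {𝒢 : AdelicGroupData K} {𝒟 : AutomorphyDatum 𝒢 A N} (π : AutomorphicRepData 𝒟)
  [StarModule ℝ A] [ContinuousStar A] [FiniteDimensional ℝ A]
  {E : Type*} [AddCommGroup E] [Module ℂ E]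
  (σK : Representation ℂ 𝒟.arch.maximalCompact E) (σ𝔤 : 𝒟.arch.lie →ₗ⁅ℝ⁆ Module.End ℂ E)
  (hE : ∀ (k : 𝒟.arch.maximalCompact) (X : 𝒟.arch.lie),
    σK k ∘ₗ σ𝔤 X ∘ₗ σK k⁻¹ =
      σ𝔤 (𝒟.arch.Ad (Subgroup.inclusion 𝒟.arch.maximalCompact_le_carrier k) X))

/-- **`H^q(𝔤, K_∞; π ⊗ E)`** — cohomology of an automorphic representation with coefficients in a
`(𝔤, K_∞)`-module `E` (e.g. a finite-dimensional representation of `G_∞`).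
[cite: BorelWallach2000, I §5.1] -/
abbrev gkCohomologyWith (h𝒟 : 𝒟.IsRegular) {ρ𝔤 : 𝒟.arch.lie →ₗ⁅ℝ⁆ Module.End ℂ π.Quot}
    (hρ : π.HasLieAction ρ𝔤) (q : ℕ) : Type _ :=
  GKTensor.cohomology 𝒟.arch π.kRep ρ𝔤 σK σ𝔤
    (π.isGKModule_of_hasLieAction_holds h𝒟 hρ).ad_compat hE q

/-- **`G(𝔸_f)` acts on `H^q(𝔤, K_∞; π ⊗ E)`** through `r(h) ⊗ 1`.
[cite: BorelJacquet1979, 4.6] [cite: BorelWallach2000, I §5.1] -/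
def cohomologyRepWith (h𝒟 : 𝒟.IsRegular) {ρ𝔤 : 𝒟.arch.lie →ₗ⁅ℝ⁆ Module.End ℂ π.Quot}
    (hρ : π.HasLieAction ρ𝔤) (q : ℕ) :
    Representation ℂ 𝒟.finiteAdelic (π.gkCohomologyWith σK σ𝔤 hE h𝒟 hρ q) :=
  GKTensor.cohomologyRep 𝒟.arch π.kRep ρ𝔤 σK σ𝔤 _ hE π.finiteRep
    (fun h X => π.finiteRep_comm_of_hasLieAction hρ h X) (fun h k => π.finiteRep_comm_kRep h k) q

/-- **The `G(𝔸_f)`-action on `H^q(𝔤, K_∞; π ⊗ E)` is smooth.**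
[cite: BorelJacquet1979, 4.6 with 4.2(a), 4.3] -/
theorem cohomologyRepWith_isSmooth (h𝒟 : 𝒟.IsRegular)
    {ρ𝔤 : 𝒟.arch.lie →ₗ⁅ℝ⁆ Module.End ℂ π.Quot} (hρ : π.HasLieAction ρ𝔤) (q : ℕ) :
    (π.cohomologyRepWith σK σ𝔤 hE h𝒟 hρ q).IsSmooth := by
  intro x
  obtain ⟨z, rfl⟩ := (gkComplex 𝒟.arch (π.kRep.tprod σK) (GKTensor.lie 𝒟.arch ρ𝔤 σ𝔤)
    (GKTensor.ad_compat 𝒟.arch π.kRep ρ𝔤 σK σ𝔤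
      (π.isGKModule_of_hasLieAction_holds h𝒟 hρ).ad_compat hE)).toCohomology_surjective q x
  haveI : Module.Finite ℝ 𝒟.arch.lie :=
    Module.Finite.of_injective (𝒟.arch.lie.incl : 𝒟.arch.lie →ₗ⁅ℝ⁆ Matrix N N A).toLinearMap
      Subtype.val_injective
  let e := Module.finBasis ℝ 𝒟.arch.lie
  have hsm := Representation.IsSmooth.tprod_one (π.isSmooth_finiteRep_holds h𝒟) E
  let S : Subgroup 𝒟.finiteAdelic :=
    ⨅ v : Fin q → Fin (Module.finrank ℝ 𝒟.arch.lie),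
      (π.finiteRep.tprod (1 : Representation ℂ 𝒟.finiteAdelic E)).stabilizerSubgroup
        ((z : ChevalleyEilenberg.Cochain ℝ 𝒟.arch.lie
          (GKCarrier 𝒟.arch (GKTensor.lie 𝒟.arch ρ𝔤 σ𝔤)) q) fun i => e (v i))
  have hS : IsOpen (S : Set 𝒟.finiteAdelic) := by
    rw [Subgroup.coe_iInf]
    exact isOpen_iInter_of_finite fun v => hsm _
  refine (π.cohomologyRepWith σK σ𝔤 hE h𝒟 hρ q).isSmoothVector_of_le hS fun h hh => ?_
  rw [Representation.mem_stabilizerSubgroup, cohomologyRepWith, GKTensor.cohomologyRep_apply,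
    gkCohomologyHom_apply, ChevalleyEilenberg.Subcomplex.IsCochainMapTo.cohomologyMap_toCohomology]
  congr 1
  refine Subtype.ext ?_
  rw [ChevalleyEilenberg.Subcomplex.IsCochainMapTo.coe_cocyclesMap]
  refine Module.Basis.ext_alternating e fun v _ => ?_
  rw [ChevalleyEilenberg.map_apply, GKCarrier.hom_apply]
  exact (Subgroup.mem_iInf.mp hh) v

end AutomorphicRepData

end Literature.NumberTheory.Automorphic
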